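import Summits.QuantumFields.GaugeBoot.DiagonalRPPlaquettes
import Literature.MathematicalPhysics.QuantumLattice.LatticeGaugeDLRBoxKernels
import HarnessLib

/-!
# The diagonal mirror `x_i = x_j`: Gram coefficients of the cut plaquettes and the partial actions
(gauge-boot, L3(β) part 3)

HONEST FRAMING (cell `pub-gaugeboot`, page 1 of every file): the venture produces certified bounds
on lattice expectations at stated coupling, gauge group, dimension and torus size; NOT a mass gap,
NOT a continuum limit, NOT a string tension; NOT Yang–Mills-summit-bearing (barriers
`FixedCouplingUltralocality`, `PerturbativeInvisibility`).

Continuation of `DiagonalRPPlaquettes.lean`, still on the configurations `LGConfig d G` of `ℤ^d`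
(no finite volume yet):

* `coeff i j ρ hρ β Q` — the coefficient functions `a_ι`, `ι ∈ Q × Fin N × Fin N × Bool`, of the
  Gram expansion of the cut plaquettes of a finite plaquette set `Q` (`√(β/2)` times a unitarised
  half-plaquette entry or its conjugate), with `sum_coeff_mul_conj`:
  `∑_ι a_ι(U) conj a_ι(ΘU) = β ∑_{p ∈ Q, cut} Re tr ρ(U_p)` (`β ≥ 0`), the bound `‖a_ι‖ ≤ √(β/2)`,
  measurability, and dependence on the links of the closed half only;
* bounds (`N #Q`), measurability and closed-half dependence of the positive and mirror parts of
  the action; `wilsonBoundaryAction_eq` (`S_Λ = N #Q - ∑_{p ∈ Q} Re tr ρ(U_p)`, `Q` the plaquettes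
  touching `Λ`); `plaqSwap_mem_plaquettesTouching` (that `Q` is swap-symmetric when `Λ` is);
* finite volume (section `Box`): for an `edgeSwap`-symmetric finite link set `Λ`, the swap
  `boxSwap` of the configurations `Λ → G` (a measure-preserving relabelling of the product Haar
  measure, `measurePreserving_boxSwap`), its compatibility with gluing a swap-symmetric boundary
  condition (`configDiagSwapZd_glueWith`), and the blocks `posBlock` / `mirrorBlock` of positive and
  mirror links of `Λ` with the facts the abstract RP mechanism asks for (mirror links fixed,
  positive links read off outside the positive block, disjointness).

The reflection-positivity theorem itself is assembled in `DiagonalRPFiniteVolume.lean`.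

References: K. Osterwalder, E. Seiler, Ann. Phys. 110 (1978) 440, §2; V. Kazakov, Z. Zheng,
arXiv:2404.16925 p. 10.
-/

noncomputable section

open MeasureTheory Complex
open scoped ComplexOrder
open Literature.Probability.LatticeModels (Site box glueWith glueWith_apply_mem glueWith_apply_not_mem
  measurable_glueWith)
open Literature.MathematicalPhysics.QuantumLattice
open Literature.MathematicalPhysics.QuantumFieldTheory (haarProbability)
open Literature.RepresentationTheory.CompactGroups

namespace Summit.QuantumFields.GaugeBoot

namespace DiagRP

variable {d N : ℕ} {i j : Fin d} {G : Type*} [Group G] [TopologicalSpace G] [IsTopologicalGroup G]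
  [CompactSpace G] [MeasurableSpace G] [BorelSpace G] [SecondCountableTopology G]
variable (ρ : G →* Matrix (Fin N) (Fin N) ℂ)

/-! ## The Gram coefficients of the cut plaquettes -/

section Coeff

variable (i j) in
/-- The coefficient functions `a_ι` of the Gram expansion of the cut plaquettes of `Q`:
for `ι = (p, a, b, s)` with `p ∈ Q` a cut plaquette, `√(β/2) σ(A_p(U))_{ab}` (`s = true`) or its
conjugate (`s = false`); zero if `p` is not cut. -/
def coeff (hρ : Continuous ρ) (β : ℝ) (Q : Finset (ZdPlaquette d)) (ι : ↥Q × Fin N × Fin N × Bool)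
    (U : LGConfig d G) : ℂ :=
  if IsCutPlaq i j (ι.1 : ZdPlaquette d) then
    (Real.sqrt (β / 2) : ℂ) *
      (if ι.2.2.2 then CompactGroup.unitarize ρ hρ (halfPlaq i j ι.1 U) ι.2.1 ι.2.2.1
        else (starRingEnd ℂ) (CompactGroup.unitarize ρ hρ (halfPlaq i j ι.1 U) ι.2.1 ι.2.2.1))
  else 0

omit [MeasurableSpace G] [BorelSpace G] [SecondCountableTopology G] in
/-- **The cut part of the Boltzmann weight is a Gram kernel** (`β ≥ 0`):
`∑_ι a_ι(U) conj a_ι(ΘU) = β ∑_{p ∈ Q, cut} Re tr ρ(U_p)`. -/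
theorem sum_coeff_mul_conj (hρ : Continuous ρ) (hij : i ≠ j) {β : ℝ} (hβ : 0 ≤ β)
    (Q : Finset (ZdPlaquette d)) (U : LGConfig d G) :
    ∑ ι, coeff i j ρ hρ β Q ι U * (starRingEnd ℂ) (coeff i j ρ hρ β Q ι (configDiagSwapZd i j U)) =
      ((β * ∑ p ∈ Q.filter (IsCutPlaq i j), plaquetteObs ρ p.1 p.2.1.1 p.2.1.2 U : ℝ) : ℂ) := by
  have hs : (Real.sqrt (β / 2) : ℂ) * (Real.sqrt (β / 2) : ℂ) = ((β / 2 : ℝ) : ℂ) := by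
    rw [← Complex.ofReal_mul, Real.mul_self_sqrt (by linarith)]
  rw [Finset.mul_sum, Complex.ofReal_sum, Finset.sum_filter, ← Finset.sum_coe_sort Q,
    Fintype.sum_prod_type]
  refine Finset.sum_congr rfl fun p _ => ?_
  by_cases hp : IsCutPlaq i j (p : ZdPlaquette d)
  · rw [if_pos hp, plaquetteObs_eq_sum_halfPlaq ρ hρ hij hp, Finset.mul_sum, Complex.ofReal_sum,
      Fintype.sum_prod_type]
    refine Finset.sum_congr rfl fun a _ => ?_
    rw [Finset.mul_sum, Complex.ofReal_sum, Fintype.sum_prod_type]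
    refine Finset.sum_congr rfl fun b _ => ?_
    rw [Fintype.sum_bool]
    simp only [coeff, if_pos hp, ↓reduceIte, Bool.false_eq_true, map_mul, Complex.conj_ofReal,
      Complex.conj_conj]
    set u := CompactGroup.unitarize ρ hρ (halfPlaq i j (p : ZdPlaquette d) U) a b
    set v := CompactGroup.unitarize ρ hρ (halfPlaq i j (p : ZdPlaquette d) (configDiagSwapZd i j U)) a b
    calc (Real.sqrt (β / 2) : ℂ) * u * ((Real.sqrt (β / 2) : ℂ) * (starRingEnd ℂ) v) +
          (Real.sqrt (β / 2) : ℂ) * (starRingEnd ℂ) u * ((Real.sqrt (β / 2) : ℂ) * v)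
        = ((Real.sqrt (β / 2) : ℂ) * (Real.sqrt (β / 2) : ℂ)) *
            (u * (starRingEnd ℂ) v + (starRingEnd ℂ) (u * (starRingEnd ℂ) v)) := by
          simp only [map_mul, Complex.conj_conj]; ring
      _ = ((β * (u * (starRingEnd ℂ) v).re : ℝ) : ℂ) := by
          rw [hs, Complex.add_conj]; push_cast; ring
  · rw [if_neg hp]
    simp [coeff, hp]

omit [MeasurableSpace G] [BorelSpace G] [SecondCountableTopology G] in
/-- The coefficient functions are bounded by `√(β/2)`. -/
theorem norm_coeff_le (hρ : Continuous ρ) (β : ℝ) (Q : Finset (ZdPlaquette d))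
    (ι : ↥Q × Fin N × Fin N × Bool) (U : LGConfig d G) :
    ‖coeff i j ρ hρ β Q ι U‖ ≤ Real.sqrt (β / 2) := by
  unfold coeff
  split_ifs with hp hs
  · rw [norm_mul, Complex.norm_real, Real.norm_eq_abs, abs_of_nonneg (Real.sqrt_nonneg _)]
    exact mul_le_of_le_one_right (Real.sqrt_nonneg _)
      (CompactGroup.norm_unitarize_apply_le_one ρ hρ _ _ _)
  · rw [norm_mul, Complex.norm_real, Real.norm_eq_abs, abs_of_nonneg (Real.sqrt_nonneg _),
      Complex.norm_conj]
    exact mul_le_of_le_one_right (Real.sqrt_nonneg _)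
      (CompactGroup.norm_unitarize_apply_le_one ρ hρ _ _ _)
  · rw [norm_zero]
    exact Real.sqrt_nonneg _

/-- The half plaquettes have measurable unitarised entries. -/
theorem measurable_unitarize_halfPlaq (hρ : Continuous ρ) (p : ZdPlaquette d) (a b : Fin N) :
    Measurable fun U : LGConfig d G => CompactGroup.unitarize ρ hρ (halfPlaq i j p U) a b :=
  (CompactGroup.continuous_entry (CompactGroup.continuous_unitarize ρ hρ) a b).measurable.comp
    ((measurable_pi_apply _).mul (measurable_pi_apply _))

/-- The coefficient functions are measurable. -/
theorem measurable_coeff (hρ : Continuous ρ) (β : ℝ) (Q : Finset (ZdPlaquette d))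
    (ι : ↥Q × Fin N × Fin N × Bool) : Measurable (coeff i j ρ hρ β Q ι : LGConfig d G → ℂ) := by
  unfold coeff
  by_cases hp : IsCutPlaq i j (ι.1 : ZdPlaquette d)
  · simp only [if_pos hp]
    by_cases hs : ι.2.2.2 = true
    · simp only [hs, ↓reduceIte]
      exact (measurable_unitarize_halfPlaq ρ hρ _ _ _).const_mul _
    · simp only [hs, Bool.false_eq_true, ↓reduceIte]
      exact (Complex.continuous_conj.measurable.comp (measurable_unitarize_halfPlaq ρ hρ _ _ _)).const_mul _
  · simp only [if_neg hp]
    exact measurable_const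

omit [MeasurableSpace G] [BorelSpace G] [SecondCountableTopology G] in
/-- The coefficient functions depend only on the links of the closed half. -/
theorem coeff_congr (hρ : Continuous ρ) (hij : i ≠ j) (β : ℝ) (Q : Finset (ZdPlaquette d))
    (ι : ↥Q × Fin N × Fin N × Bool) {U V : LGConfig d G}
    (hUV : ∀ e ∈ diagHalfEdges i j, U e = V e) : coeff i j ρ hρ β Q ι U = coeff i j ρ hρ β Q ι V := by
  unfold coeff
  by_cases hp : IsCutPlaq i j (ι.1 : ZdPlaquette d)
  · obtain ⟨h1, h2⟩ := isPosEdge_of_isCutPlaq hij hp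
    simp only [if_pos hp, halfPlaq_congr (ι.1 : ZdPlaquette d) (hUV _ h1.1) (hUV _ h2.1)]
  · simp only [if_neg hp]

end Coeff

/-! ## Bounds, measurability and dependence of the partial actions -/

section Action

omit [MeasurableSpace G] [BorelSpace G] [SecondCountableTopology G] in
/-- A partial sum of plaquette observables over a subset of `Q` is bounded by `N #Q`. -/
theorem abs_sum_filter_plaquetteObs_le (hρ : Continuous ρ) (Q : Finset (ZdPlaquette d))
    (P : ZdPlaquette d → Prop) [DecidablePred P] (U : LGConfig d G) :
    |∑ p ∈ Q.filter P, plaquetteObs ρ p.1 p.2.1.1 p.2.1.2 U| ≤ N * Q.card := by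
  calc |∑ p ∈ Q.filter P, plaquetteObs ρ p.1 p.2.1.1 p.2.1.2 U|
      ≤ ∑ p ∈ Q.filter P, |plaquetteObs ρ p.1 p.2.1.1 p.2.1.2 U| := Finset.abs_sum_le_sum_abs _ _
    _ ≤ ∑ _p ∈ Q.filter P, (N : ℝ) := Finset.sum_le_sum fun p _ => by
        simpa [plaquetteObs] using
          CompactGroup.abs_re_trace_le_card ρ hρ (plaquetteHolonomyZd U p.1 p.2.1.1 p.2.1.2)
    _ ≤ N * Q.card := by
        rw [Finset.sum_const, nsmul_eq_mul, mul_comm]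
        exact mul_le_mul_of_nonneg_left (by exact_mod_cast Finset.card_filter_le Q P) (Nat.cast_nonneg _)

omit [CompactSpace G] in
/-- A partial sum of plaquette observables is measurable. -/
theorem measurable_sum_plaquetteObs (hρ : Continuous ρ) (S : Finset (ZdPlaquette d)) :
    Measurable fun U : LGConfig d G => ∑ p ∈ S, plaquetteObs ρ p.1 p.2.1.1 p.2.1.2 U :=
  (continuous_finsetSum S fun p _ => continuous_plaquetteObs ρ hρ p.1 p.2.1.1 p.2.1.2).measurable

omit [TopologicalSpace G] [IsTopologicalGroup G] [CompactSpace G] [MeasurableSpace G] [BorelSpace G]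
  [SecondCountableTopology G] in
/-- The positive part `A(U)` of the action depends only on the links of the closed half. -/
theorem sum_pos_congr (hij : i ≠ j) (Q : Finset (ZdPlaquette d)) {U V : LGConfig d G}
    (hUV : ∀ e ∈ diagHalfEdges i j, U e = V e) :
    ∑ p ∈ Q.filter (IsPosPlaq i j), plaquetteObs ρ p.1 p.2.1.1 p.2.1.2 U =
      ∑ p ∈ Q.filter (IsPosPlaq i j), plaquetteObs ρ p.1 p.2.1.1 p.2.1.2 V :=
  Finset.sum_congr rfl fun p hp => plaquetteObs_congr ρ p fun e he =>
    hUV e (mem_diagHalfEdges_of_isPosPlaq hij (Finset.mem_filter.1 hp).2 he)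

omit [TopologicalSpace G] [IsTopologicalGroup G] [CompactSpace G] [MeasurableSpace G] [BorelSpace G]
  [SecondCountableTopology G] in
/-- The mirror part `M(U)` of the action depends only on the links of the closed half. -/
theorem sum_mirror_congr (Q : Finset (ZdPlaquette d)) {U V : LGConfig d G}
    (hUV : ∀ e ∈ diagHalfEdges i j, U e = V e) :
    ∑ p ∈ Q.filter (IsMirrorPlaq i j), plaquetteObs ρ p.1 p.2.1.1 p.2.1.2 U =
      ∑ p ∈ Q.filter (IsMirrorPlaq i j), plaquetteObs ρ p.1 p.2.1.1 p.2.1.2 V :=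
  Finset.sum_congr rfl fun p hp => plaquetteObs_congr ρ p fun e he =>
    hUV e (mem_diagHalfEdges_of_isMirrorPlaq (Finset.mem_filter.1 hp).2 he)

omit [TopologicalSpace G] [IsTopologicalGroup G] [CompactSpace G] [MeasurableSpace G] [BorelSpace G]
  [SecondCountableTopology G] in
/-- The boundary Wilson action as `N #Q - ∑_{p ∈ Q} Re tr ρ(U_p)`, `Q` the plaquettes touching `Λ`. -/
theorem wilsonBoundaryAction_eq (Λ : Finset (ZdEdge d)) (U : LGConfig d G) :
    wilsonBoundaryAction ρ Λ U = N * (plaquettesTouching Λ).card -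
      ∑ p ∈ plaquettesTouching Λ, plaquetteObs ρ p.1 p.2.1.1 p.2.1.2 U := by
  rw [wilsonBoundaryAction, Finset.sum_sub_distrib, Finset.sum_const, nsmul_eq_mul, mul_comm]

omit [Group G] [TopologicalSpace G] [IsTopologicalGroup G] [CompactSpace G] [MeasurableSpace G]
  [BorelSpace G] [SecondCountableTopology G] in
/-- **The plaquettes touching a swap-symmetric link set form a swap-symmetric set.** -/
theorem plaqSwap_mem_plaquettesTouching {Λ : Finset (ZdEdge d)} (hΛ : ∀ e ∈ Λ, edgeSwap i j e ∈ Λ)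
    {p : ZdPlaquette d} (hp : p ∈ plaquettesTouching Λ) : plaqSwap i j p ∈ plaquettesTouching Λ := by
  rw [mem_plaquettesTouching_iff] at hp ⊢
  obtain ⟨e, he⟩ := hp
  rw [Finset.mem_inter] at he
  refine ⟨edgeSwap i j e, Finset.mem_inter.2 ⟨?_, hΛ e he.2⟩⟩
  rw [plaquetteEdges_plaqSwap]
  exact Finset.mem_image_of_mem _ he.1

end Action

/-! ## The swap on the configurations of a symmetric finite link set -/

section Box

variable {Λ : Finset (ZdEdge d)}

omit [Group G] [TopologicalSpace G] [IsTopologicalGroup G] [CompactSpace G] [MeasurableSpace G]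
  [BorelSpace G] [SecondCountableTopology G] in
/-- A swap-symmetric link set: membership is swap-invariant. -/
theorem mem_iff_edgeSwap_mem (hΛ : ∀ e ∈ Λ, edgeSwap i j e ∈ Λ) (e : ZdEdge d) :
    e ∈ Λ ↔ edgeSwap i j e ∈ Λ :=
  ⟨hΛ e, fun h => by simpa using hΛ _ h⟩

/-- The swap of the links of a symmetric `Λ`, as a permutation of `Λ`. -/
def boxEdgeSwap (hΛ : ∀ e ∈ Λ, edgeSwap i j e ∈ Λ) : Equiv.Perm ↥Λ :=
  Function.Involutive.toPerm (fun e => ⟨edgeSwap i j e.1, hΛ e.1 e.2⟩) fun e =>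
    Subtype.ext (edgeSwap_edgeSwap i j e.1)

/-- The swap on the configurations `Λ → G` of the links of a symmetric `Λ`. -/
def boxSwap (hΛ : ∀ e ∈ Λ, edgeSwap i j e ∈ Λ) (ζ : ↥Λ → G) : ↥Λ → G := fun e => ζ (boxEdgeSwap hΛ e)

omit [TopologicalSpace G] [IsTopologicalGroup G] [CompactSpace G] [MeasurableSpace G] [BorelSpace G]
  [SecondCountableTopology G] in
/-- **Gluing commutes with the swap** for a symmetric link set and a symmetric boundary condition:
`Θ (ζ η_{Λᶜ}) = (boxSwap ζ) η_{Λᶜ}`. -/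
theorem configDiagSwapZd_glueWith (hΛ : ∀ e ∈ Λ, edgeSwap i j e ∈ Λ) {η : LGConfig d G}
    (hη : configDiagSwapZd i j η = η) (ζ : ↥Λ → G) :
    configDiagSwapZd i j (glueWith Λ ζ η) = glueWith Λ (boxSwap hΛ ζ) η := by
  funext e
  rw [configDiagSwapZd_apply]
  by_cases he : e ∈ Λ
  · rw [glueWith_apply_mem _ _ _ (hΛ e he), glueWith_apply_mem _ _ _ he]; rfl
  · have he' : edgeSwap i j e ∉ Λ := fun h => he ((mem_iff_edgeSwap_mem hΛ e).2 h)
    rw [glueWith_apply_not_mem _ _ _ he', glueWith_apply_not_mem _ _ _ he]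
    exact congrFun hη e

omit [SecondCountableTopology G] in
/-- **The swap preserves the product Haar measure** on `Λ → G` (a relabelling of the factors). -/
theorem measurePreserving_boxSwap (hΛ : ∀ e ∈ Λ, edgeSwap i j e ∈ Λ) :
    MeasurePreserving (boxSwap (G := G) hΛ) (Measure.pi fun _ : ↥Λ => haarProbability G)
      (Measure.pi fun _ : ↥Λ => haarProbability G) := by
  have h := measurePreserving_arrowCongr' (fun _ : ↥Λ => haarProbability G)
    (fun _ : ↥Λ => haarProbability G) (boxEdgeSwap hΛ) (MeasurableEquiv.refl G)
    fun _ => MeasurePreserving.id _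
  have heq : boxSwap (G := G) hΛ =
      ⇑(MeasurableEquiv.arrowCongr' (boxEdgeSwap (i := i) (j := j) hΛ) (MeasurableEquiv.refl G)) := by
    funext ζ e; rfl
  rw [heq]
  exact h

open Classical in
/-- The positive links of `Λ` (block `P` of the mechanism). -/
def posBlock (i j : Fin d) (Λ : Finset (ZdEdge d)) : Finset ↥Λ :=
  Finset.univ.filter fun e => IsPosEdge i j e.1

open Classical in
/-- The mirror links of `Λ` (shared block `M` of the mechanism). -/
def mirrorBlock (i j : Fin d) (Λ : Finset (ZdEdge d)) : Finset ↥Λ :=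
  Finset.univ.filter fun e => IsMirrorEdge i j e.1

omit [Group G] [TopologicalSpace G] [IsTopologicalGroup G] [CompactSpace G] [MeasurableSpace G]
  [BorelSpace G] [SecondCountableTopology G] in
/-- Membership in the positive block. -/
theorem mem_posBlock {e : ↥Λ} : e ∈ posBlock i j Λ ↔ IsPosEdge i j e.1 := by
  classical
  simp [posBlock]

omit [Group G] [TopologicalSpace G] [IsTopologicalGroup G] [CompactSpace G] [MeasurableSpace G]
  [BorelSpace G] [SecondCountableTopology G] in
/-- Membership in the mirror block. -/
theorem mem_mirrorBlock {e : ↥Λ} : e ∈ mirrorBlock i j Λ ↔ IsMirrorEdge i j e.1 := by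
  classical
  simp [mirrorBlock]

omit [Group G] [TopologicalSpace G] [IsTopologicalGroup G] [CompactSpace G] [MeasurableSpace G]
  [BorelSpace G] [SecondCountableTopology G] in
/-- The swap fixes the mirror links. -/
theorem boxSwap_apply_of_mem_mirrorBlock (hΛ : ∀ e ∈ Λ, edgeSwap i j e ∈ Λ) (ζ : ↥Λ → G) (e : ↥Λ)
    (he : e ∈ mirrorBlock i j Λ) : boxSwap hΛ ζ e = ζ e :=
  congrArg ζ (Subtype.ext (edgeSwap_of_isMirrorEdge i j (mem_mirrorBlock.1 he)))

omit [Group G] [TopologicalSpace G] [IsTopologicalGroup G] [CompactSpace G] [MeasurableSpace G]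
  [BorelSpace G] [SecondCountableTopology G] in
/-- The swapped value of a positive link is read off a link outside the positive block. -/
theorem dependsOn_boxSwap_apply (hΛ : ∀ e ∈ Λ, edgeSwap i j e ∈ Λ) (e : ↥Λ)
    (he : e ∈ posBlock i j Λ ∪ ∅) :
    DependsOn (fun ζ : ↥Λ → G => boxSwap hΛ ζ e) (((posBlock i j Λ)ᶜ : Finset ↥Λ) : Set ↥Λ) := by
  intro ζ ζ' h
  rw [Finset.union_empty] at he
  refine h (boxEdgeSwap hΛ e) ?_
  rw [Finset.coe_compl, Set.mem_compl_iff, Finset.mem_coe, mem_posBlock]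
  exact fun hp => not_mem_diagHalfEdges_edgeSwap (mem_posBlock.1 he) hp.1

omit [Group G] [TopologicalSpace G] [IsTopologicalGroup G] [CompactSpace G] [MeasurableSpace G]
  [BorelSpace G] [SecondCountableTopology G] in
/-- The mirror and positive blocks are disjoint. -/
theorem disjoint_mirrorBlock_posBlock : Disjoint (mirrorBlock i j Λ) (posBlock i j Λ) :=
  Finset.disjoint_left.2 fun _ hm hp => (mem_posBlock.1 hp).2 (mem_mirrorBlock.1 hm)

omit [Group G] [TopologicalSpace G] [IsTopologicalGroup G] [CompactSpace G] [MeasurableSpace G]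
  [BorelSpace G] [SecondCountableTopology G] in
/-- Two configurations of `Λ` agreeing on the positive and mirror links glue to configurations
agreeing on the closed half. -/
theorem glueWith_eq_of_eq_on_blocks (η : LGConfig d G) {ζ ζ' : ↥Λ → G}
    (h : ∀ e ∈ ((posBlock i j Λ ∪ ∅ ∪ mirrorBlock i j Λ : Finset ↥Λ) : Set ↥Λ), ζ e = ζ' e) :
    ∀ e ∈ diagHalfEdges i j, glueWith Λ ζ η e = glueWith Λ ζ' η e := by
  intro e he
  by_cases heΛ : e ∈ Λ
  · rw [glueWith_apply_mem _ _ _ heΛ, glueWith_apply_mem _ _ _ heΛ]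
    apply h
    rw [Finset.union_empty, Finset.coe_union, Set.mem_union, Finset.mem_coe, Finset.mem_coe,
      mem_posBlock, mem_mirrorBlock]
    exact (mem_diagHalfEdges_iff_pos_or_mirror i j e).1 he
  · rw [glueWith_apply_not_mem _ _ _ heΛ, glueWith_apply_not_mem _ _ _ heΛ]

end Box

end DiagRP

end Summit.QuantumFields.GaugeBoot
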